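import Summits.QuantumFields.YangMills.Theorems.ParabolicTrajectoryLatticeGapOnTrajectorySparseDefectDefs
import Summits.QuantumFields.YangMills.Theorems.ParabolicTrajectoryLatticeGapOnTrajectoryStubSlabClustering
import HarnessLib

/-!
# Crux `LatticeGapOnTrajectory` (stmt-QuantumFields-10523), line `sparse-defect-orbit-window`
# (`SketchIdeator5-r2`): slab clustering THROUGH THE DECAY INTERFACE — one torus, far case
# (helper file for the registered stub `stub_slabClusteringOfDecay`)

A mechanical fork of the landed slab-clustering chain of the line `orbit-kantorovich-finite-size`
(`…SlabClusteringGeometry` §1, `…SlabClusteringFar`; stub `stub_slabClustering`, p123095) in which the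
Dobrushin–Shlosman ENGINE hypothesis (`hEng`, the conclusion of `KREngine`) and the orbit–Kantorovich
WINDOW package (`hphys : … → ∃ kp, IsKRWindow …`) are replaced by the engine-independent decay
interface `CellDecay` of `…SparseDefectDefs` (verbatim the engine's output inequality for one
`(cell, w, ν)`). The landed chain touches the engine at exactly one call site, so every proof here is
the landed proof with that one line re-plumbed; all other lemmas of the chain (label / slab geometry,
finite range of region averages, TV-Lipschitz bounds in the orbit weight, the complex covariance
bound) are imported unchanged.

* §1 `abs_corr_le_of_layers_of_decay`: the two-region TOWER identity
  `∫ f g − ∫ f ∫ g = cov(γ_{Λ_F} f, γ_{Λ_G} g)` (DLR for functions + pull-out, `SpecificationTower`)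
  followed by cell decay of `ν` applied to the two region averages (functions of cell layers
  `Δ_F, Δ_G` with constant cell-Lipschitz bounds): `|…| ≤ C₀ (|Δ_F| δ_F)(|Δ_G| δ_G) e^{−κ D}`.
* §2 One torus, far case (`3b ≤ N`): `abs_cov_slab_le_far_of_decay` (uniform frames of scale `b`,
  the two label regions, finite range, TV-Lipschitz bounds `δ = 2B(1 + 2e²|β|α·7680 b⁴)`, §1 at
  coarse distance `N/b − 3`) and its complex form for the reflected autocorrelation
  `norm_osCorr_le_far_of_decay` (four real covariances).
* The stub itself (polynomial bookkeeping, near case, eventualities in `k`) is in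
  `…StubSlabClusteringOfDecay.lean`, which imports this file.

References: Dobrushin–Shlosman 1985; Föllmer 1988 Ch. I §2; Georgii 2011 Def. 1.23, §8.2.
-/

set_option autoImplicit false

noncomputable section

namespace Summit.QuantumFields.YangMills.Cruxes.LatticeGapOnTrajectory.SparseDefectOrbitWindow

open scoped BigOperators Topology ENNReal ProbabilityTheory ComplexConjugate
open Filter MeasureTheory
open Literature.Probability.LatticeModels (Specification IsSpecification IsGibbsMeasure glueWith)
open Literature.MathematicalPhysics.QuantumLattice
open Literature.MathematicalPhysics.QuantumFieldTheory
open Summit.QuantumFields.YangMills.Theses.ParabolicTrajectory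
open Summit.QuantumFields.YangMills.Cruxes.LatticeGapOnTrajectory.OrbitKantorovichFiniteSize
open Summit.QuantumFields.YangMills.Cruxes.LatticeGapOnTrajectory.OrbitKantorovichFiniteSize.SlabClustering

namespace SlabClusteringOfDecay

/-! ### §1 The two-region tower identity, through the decay interface -/

/-- **Two-region tower identity + cell decay.** For a specification `γ` on a finite site set read
on cells, a Gibbs measure `ν` of `γ` with cell-scale covariance decay `CellDecay cell w ν κ C₀`,
bounded measurable `f`, `g` with `g` reading only `Λ_G`, disjoint from `Λ_F`, whose region
averages `γ_{Λ_F} f`, `γ_{Λ_G} g` read only the cell layers `Δ_F`, `Δ_G` (with `Δ_F` off `Λ_G`)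
and are cell-Lipschitz with constant bounds `δ_F`, `δ_G`, and `D ≤ cdist` between `Δ_F` and `Δ_G`:
`|∫ f g dν − ∫ f dν ∫ g dν| ≤ C₀ (|Δ_F| δ_F) (|Δ_G| δ_G) e^{−κ D}`
(`∫ f g = ∫ γ_{Λ_F}(g f) = ∫ g γ_{Λ_F} f = ∫ γ_{Λ_G}(γ_{Λ_F}f · g) = ∫ γ_{Λ_F} f · γ_{Λ_G} g`).
Fork of `SlabClustering.abs_corr_le_of_layers` with the engine hypothesis replaced by `CellDecay`. -/
theorem abs_corr_le_of_layers_of_decay {μ : Fin 4 → ℕ} {V S : Type} [Fintype V] [MeasurableSpace S]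
    (hT : SpecificationTower) {κ C₀ : ℝ}
    (cell : V → CoarseIdx μ) (w : CoarseIdx μ → (V → S) → (V → S) → ℝ) (γ : Specification V S)
    (hγ : IsSpecification γ) (ν : Measure (V → S)) (hν : IsGibbsMeasure γ ν)
    (hdec : CellDecay cell w ν κ C₀)
    {f g : (V → S) → ℝ} {CA CB : ℝ} (hfm : Measurable f) (hgm : Measurable g)
    (hfb : ∀ σ, |f σ| ≤ CA) (hgb : ∀ σ, |g σ| ≤ CB)
    (ΛF ΛG : Finset V) (hgdep : DependsOn g (↑ΛG : Set V))
    (hdisj : Disjoint ΛF ΛG) (ΔF ΔG : Finset (CoarseIdx μ))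
    (hFh : DependsOn (windowAvg γ ΛF f) {v | cell v ∈ ΔF})
    (hGh : DependsOn (windowAvg γ ΛG g) {v | cell v ∈ ΔG})
    (hΔFG : ∀ v ∈ ΛG, cell v ∉ ΔF) {δF δG : ℝ}
    (hLipF : IsCellLipBound cell w (windowAvg γ ΛF f) (fun _ => δF))
    (hLipG : IsCellLipBound cell w (windowAvg γ ΛG g) (fun _ => δG))
    (D : ℕ) (hD : ∀ x ∈ ΔF, ∀ y ∈ ΔG, D ≤ cdist x y) :
    |(∫ σ, f σ * g σ ∂ν) - (∫ σ, f σ ∂ν) * ∫ σ, g σ ∂ν| ≤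
      C₀ * (ΔF.card * δF) * (ΔG.card * δG) * Real.exp (-(κ * D)) := by
  -- adapted from `SlabClustering.abs_corr_le_of_layers` (…SlabClusteringGeometry): the engine call
  -- is replaced by the decay interface `hdec`
  classical
  haveI : IsProbabilityMeasure ν := hν.1
  obtain ⟨hfhm, hfhb, -, hpullF, hdlrF⟩ := hT V S γ hγ ΛF f CA hfm hfb
  obtain ⟨hghm, hghb, -, hpullG, hdlrG⟩ := hT V S γ hγ ΛG g CB hgm hgb
  set fh : (V → S) → ℝ := windowAvg γ ΛF f with hfh
  set gh : (V → S) → ℝ := windowAvg γ ΛG g with hgh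
  have hg_offF : DependsOn g ((↑ΛF : Set V)ᶜ) :=
    hgdep.mono fun v hv => Finset.disjoint_right.1 hdisj (Finset.mem_coe.1 hv)
  have hfh_offG : DependsOn fh ((↑ΛG : Set V)ᶜ) := hFh.mono fun v hv hvG =>
    hΔFG v (Finset.mem_coe.1 hvG) hv
  have hgf_b : ∀ σ, |g σ * f σ| ≤ CB * CA := fun σ => by
    rw [abs_mul]
    exact mul_le_mul (hgb σ) (hfb σ) (abs_nonneg _) ((abs_nonneg _).trans (hgb σ))
  have hfhg_b : ∀ σ, |fh σ * g σ| ≤ CA * CB := fun σ => by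
    rw [abs_mul]
    exact mul_le_mul (hfhb σ) (hgb σ) (abs_nonneg _) ((abs_nonneg _).trans (hfhb σ))
  have step1 : ∫ σ, f σ * g σ ∂ν = ∫ σ, g σ * fh σ ∂ν := by
    have hdlr := (hT V S γ hγ ΛF (fun σ => g σ * f σ) (CB * CA) (hgm.mul hfm) hgf_b).2.2.2.2 ν hν
    have hp : ∀ η, windowAvg γ ΛF (fun σ => g σ * f σ) η = g η * fh η :=
      hpullF g hgm ⟨CB, hgb⟩ hg_offF
    simp_rw [hp] at hdlr
    rw [hdlr]
    exact integral_congr_ae (Eventually.of_forall fun σ => mul_comm _ _)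
  have step2 : ∫ σ, g σ * fh σ ∂ν = ∫ σ, fh σ * gh σ ∂ν := by
    have hdlr := (hT V S γ hγ ΛG (fun σ => fh σ * g σ) (CA * CB) (hfhm.mul hgm) hfhg_b).2.2.2.2 ν hν
    have hp : ∀ η, windowAvg γ ΛG (fun σ => fh σ * g σ) η = fh η * gh η :=
      hpullG fh hfhm ⟨CA, hfhb⟩ hfh_offG
    simp_rw [hp] at hdlr
    rw [hdlr]
    exact integral_congr_ae (Eventually.of_forall fun σ => mul_comm _ _)
  have step3 : ∫ σ, f σ ∂ν = ∫ σ, fh σ ∂ν := (hdlrF ν hν).symm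
  have step4 : ∫ σ, g σ ∂ν = ∫ σ, gh σ ∂ν := (hdlrG ν hν).symm
  have hfh2 : MemLp fh 2 ν := MemLp.of_bound hfhm.aestronglyMeasurable CA
    (Eventually.of_forall fun σ => by rw [Real.norm_eq_abs]; exact hfhb σ)
  have hgh2 : MemLp gh 2 ν := MemLp.of_bound hghm.aestronglyMeasurable CB
    (Eventually.of_forall fun σ => by rw [Real.norm_eq_abs]; exact hghb σ)
  have hcov : cov[fh, gh; ν] = (∫ σ, fh σ * gh σ ∂ν) - (∫ σ, fh σ ∂ν) * ∫ σ, gh σ ∂ν :=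
    ProbabilityTheory.covariance_eq_sub hfh2 hgh2
  have htower : (∫ σ, f σ * g σ ∂ν) - (∫ σ, f σ ∂ν) * ∫ σ, g σ ∂ν = cov[fh, gh; ν] := by
    rw [hcov, step1, step2, step3, step4]
  have hcovb := hdec fh gh ΔF ΔG (fun _ => δF) (fun _ => δG) D
    hfhm hghm ⟨CA, hfhb⟩ ⟨CB, hghb⟩ hFh hGh hLipF hLipG hD
  rw [htower]
  refine hcovb.trans (le_of_eq ?_)
  rw [Finset.sum_const, Finset.sum_const, nsmul_eq_mul, nsmul_eq_mul]

/-! ### §2 One torus, far case, through the decay interface -/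

section OneTorus

variable {G : Type} [Group G] [TopologicalSpace G] [IsTopologicalGroup G] [CompactSpace G]
  [MeasurableSpace G] [BorelSpace G] (r : LatticeRep G)

/-- **One torus, far case, through the decay interface.** On the torus of side `2L+1` at
coupling `β`, with uniform frames of scale `b` (`K + 1 = (2L+1)/b ≥ 2n₀+3` cells per axis,
`4b ≤ L`), two bounded measurable real observables `f` (reading the links based at times
`≥ 2L − w`) and `g` (times `N+1 … N+w`), `N + 2w ≤ L`, `3b ≤ N`, and cell-scale covariance decay
`(κ, C₀)` of Wilson's torus measure read on the cells in the capped orbit weight at resolution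
`α` for every family of frames of scale `b`:
`|∫ f g − ∫ f ∫ g| ≤ C₀ ((K+1)⁴ δ)² e^{−κ(N/b − 3)}`, `δ = 2B(1 + 2e²|β|α·7680 b⁴)`
(regions `Λ_F ⊇ supp f`, `Λ_G ⊇ supp g` = label intervals; finite range; TV-Lipschitz bounds on
the adjacent layers, `0` elsewhere; two-region tower identity; decay). Fork of
`SlabClustering.abs_cov_slab_le_far`. -/
theorem abs_cov_slab_le_far_of_decay (hT : SpecificationTower) {n₀ : ℕ} {κ C₀ : ℝ} (hC₀ : 0 ≤ C₀)
    (β α : ℝ) (hα : 0 < α) {L b K w N : ℕ} (hb : 0 < b) (hK : K + 1 = (2 * L + 1) / b)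
    (hbL : 4 * b ≤ L) (hNw : N + 2 * w ≤ L) (hN : 3 * b ≤ N) (hn₀ : 2 * n₀ + 3 ≤ K + 1)
    (hγ : IsSpecification (torusYM r.ρ β (2 * L + 1)))
    (hGibbs : IsGibbsMeasure (torusYM r.ρ β (2 * L + 1)) (wilsonMeasure (d := 4) (L := 2 * L + 1) r.ρ β))
    (hdec : ∀ (μ : Fin 4 → ℕ) (q : (i : Fin 4) → ZMod (2 * L + 1) → ZMod (μ i + 1)),
        (∀ i, 2 * n₀ + 3 ≤ μ i + 1) → (∀ i, IsTorusFrame (2 * L + 1) b (q i)) →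
          CellDecay (cellOf q) (orbitWeight r α q)
            (wilsonMeasure (d := 4) (L := 2 * L + 1) r.ρ β) κ C₀)
    {f g : GaugeConfig 4 (2 * L + 1) G → ℝ} {B : ℝ} (hfm : Measurable f) (hgm : Measurable g)
    (hfb : ∀ U, |f U| ≤ B) (hgb : ∀ U, |g U| ≤ B)
    (hfdep : DependsOn f {e : Edge 4 (2 * L + 1) | 2 * L - w ≤ (e.1 0).val})
    (hgdep : DependsOn g {e : Edge 4 (2 * L + 1) | 1 + N ≤ (e.1 0).val ∧ (e.1 0).val ≤ w + N}) :
    |(∫ U, f U * g U ∂(wilsonMeasure (d := 4) (L := 2 * L + 1) r.ρ β)) -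
        (∫ U, f U ∂(wilsonMeasure (d := 4) (L := 2 * L + 1) r.ρ β)) *
          ∫ U, g U ∂(wilsonMeasure (d := 4) (L := 2 * L + 1) r.ρ β)| ≤
      C₀ * ((K + 1 : ℝ) ^ 4 * (2 * B * (1 + 2 * Real.exp 2 * |β| * α * (7680 * (b : ℝ) ^ 4)))) ^ 2 *
        Real.exp (-(κ * (N / b - 3 : ℕ))) := by
  -- adapted from `SlabClustering.abs_cov_slab_le_far` (…SlabClusteringFar): the window package
  -- `hphys` + engine are replaced by the decay interface `hdec`
  classical
  -- the frames: uniform frames of scale `b`, time origin `o`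
  set o : ZMod (2 * L + 1) := -(((w + 1 + 2 * b : ℕ) : ZMod (2 * L + 1))) with ho
  set μ : Fin 4 → ℕ := fun _ => K with hμdef
  set q : (i : Fin 4) → ZMod (2 * L + 1) → ZMod (μ i + 1) :=
    fun i => StubTorusFrames.uframe (2 * L + 1) b K (if i = 0 then o else 0) with hqdef
  have hframe : ∀ i, IsTorusFrame (2 * L + 1) b (q i) := fun i =>
    ⟨StubTorusFrames.uframe_step hb hK _, StubTorusFrames.uframe_fibre hb hK _⟩
  have hdecq := hdec μ q (fun _ => hn₀) hframe
  have hcell : ∀ e : Edge 4 (2 * L + 1),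
      cellOf q e 0 = ((StubTorusFrames.ulabel b K (e.1 0 - o).val : ℕ) : ZMod (μ 0 + 1)) := fun e => by
    simp [cellOf, siteCell, hqdef, StubTorusFrames.uframe]
  obtain ⟨hapart, hg₂K, hpairs⟩ := slab_labels_apart hb hK hbL hNw hN
  have hg12 : (N + w + 2) / b ≤ (N + 2 * w + 1) / b + 1 := by
    rw [← Nat.add_div_right _ hb]; exact Nat.div_le_div_right (by omega)
  have hwL : w ≤ L := by omega
  -- the label data as opaque naturals (for `omega`)
  have hneg := fun (z : ZMod (2 * L + 1)) (hz : 2 * L - w ≤ z.val) => label_negSlab hb hK hbL hwL z hz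
  have hpos := fun (z : ZMod (2 * L + 1)) (hz1 : N + 1 ≤ z.val) (hz2 : z.val ≤ N + w) =>
    label_posSlab hb hK hbL hNw z hz1 hz2
  set wb := w / b with hwb
  set g₁ := (N + w + 2) / b with hg₁
  set g₂ := (N + 2 * w + 1) / b with hg₂
  set nb := N / b with hnb
  clear_value wb g₁ g₂ nb
  have F1 : 2 + wb + 1 ≤ K := by omega
  have F5 : g₁ + 2 - 1 ≤ K := by omega
  -- regions and layers
  set ΛF : Finset (Edge 4 (2 * L + 1)) := Finset.univ.filter fun e : Edge 4 (2 * L + 1) =>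
    2 ≤ StubTorusFrames.ulabel b K (e.1 0 - o).val ∧
      StubTorusFrames.ulabel b K (e.1 0 - o).val ≤ 2 + wb with hΛF
  set ΛG : Finset (Edge 4 (2 * L + 1)) := Finset.univ.filter fun e : Edge 4 (2 * L + 1) =>
    g₁ + 2 ≤ StubTorusFrames.ulabel b K (e.1 0 - o).val ∧
      StubTorusFrames.ulabel b K (e.1 0 - o).val ≤ g₂ + 2 with hΛG
  set ΔF : Finset (CoarseIdx μ) := Finset.univ.filter fun c : CoarseIdx μ =>
    c 0 = ((2 - 1 : ℕ) : ZMod (μ 0 + 1)) ∨ c 0 = ((2 + wb + 1 : ℕ) : ZMod (μ 0 + 1)) with hΔF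
  set ΔG : Finset (CoarseIdx μ) := Finset.univ.filter fun c : CoarseIdx μ =>
    c 0 = ((g₁ + 2 - 1 : ℕ) : ZMod (μ 0 + 1)) ∨ c 0 = ((g₂ + 2 + 1 : ℕ) : ZMod (μ 0 + 1)) with hΔG
  -- supports
  have hfΛ : DependsOn f (↑ΛF : Set (Edge 4 (2 * L + 1))) := hfdep.mono fun e he =>
    Finset.mem_coe.2 (Finset.mem_filter.2 ⟨Finset.mem_univ _, hneg (e.1 0) he⟩)
  have hgΛ : DependsOn g (↑ΛG : Set (Edge 4 (2 * L + 1))) := hgdep.mono fun e he =>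
    Finset.mem_coe.2 (Finset.mem_filter.2 ⟨Finset.mem_univ _,
      hpos (e.1 0) (by have := he.1; omega) (by have := he.2; omega)⟩)
  have hdisj : Disjoint ΛF ΛG := by
    rw [Finset.disjoint_left]
    intro e h1 h2
    have a := (Finset.mem_filter.1 h1).2
    have a' := (Finset.mem_filter.1 h2).2
    omega
  -- finite range of the two region averages
  have hFRF := dependsOn_windowAvg_interval r hb hK o β (lo := 2) (hi := 2 + wb) (by norm_num)
    F1 hfm hfΛ
  have hFRG := dependsOn_windowAvg_interval r hb hK o β (lo := g₁ + 2) (hi := g₂ + 2)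
    (by omega) hg₂K hgm hgΛ
  have hFh : DependsOn (windowAvg (torusYM r.ρ β (2 * L + 1)) ΛF f) {v | cellOf q v ∈ ΔF} :=
    hFRF.mono fun e he => by
      show cellOf q e ∈ ΔF
      refine Finset.mem_filter.2 ⟨Finset.mem_univ _, ?_⟩
      rw [hcell e]
      rcases he with h | h
      · left; rw [h]
      · right; rw [h]
  have hGh : DependsOn (windowAvg (torusYM r.ρ β (2 * L + 1)) ΛG g) {v | cellOf q v ∈ ΔG} :=
    hFRG.mono fun e he => by
      show cellOf q e ∈ ΔG
      refine Finset.mem_filter.2 ⟨Finset.mem_univ _, ?_⟩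
      rw [hcell e]
      rcases he with h | h
      · left; rw [h]
      · right; rw [h]
  have hΔFG : ∀ v ∈ ΛG, cellOf q v ∉ ΔF := fun v hv hΔ => by
    have hl := (Finset.mem_filter.1 hv).2
    have hΔ' := (Finset.mem_filter.1 hΔ).2
    rw [hcell v] at hΔ'
    have hK1 : StubTorusFrames.ulabel b K (v.1 0 - o).val ≤ K := ulabel_le _
    rcases hΔ' with h | h
    · have := natCast_inj_of_le hK1 (by omega) h; omega
    · have := natCast_inj_of_le hK1 (by omega) h; omega
  -- the Lipschitz bounds: TV-Lipschitz on the adjacent layers, finite range elsewhere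
  set δ : ℝ := 2 * B * (1 + 2 * Real.exp 2 * |β| * α * (7680 * (b : ℝ) ^ 4)) with hδ
  have hB : 0 ≤ B := (abs_nonneg _).trans (hfb fun _ => 1)
  have hδ0 : 0 ≤ δ := by positivity
  have hw0 : ∀ c σ τ, 0 ≤ orbitWeight r α q c σ τ := fun c σ τ =>
    le_min zero_le_one (div_nonneg (cellDev_nonneg r q c σ τ) hα.le)
  have hLip : ∀ {lo hi : ℕ} {h : GaugeConfig 4 (2 * L + 1) G → ℝ}, 1 ≤ lo → lo ≤ K + 1 → hi + 1 ≤ K →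
      Measurable h → (∀ U, |h U| ≤ B) →
      DependsOn h (↑(Finset.univ.filter fun e : Edge 4 (2 * L + 1) =>
        lo ≤ StubTorusFrames.ulabel b K (e.1 0 - o).val ∧
          StubTorusFrames.ulabel b K (e.1 0 - o).val ≤ hi) : Set (Edge 4 (2 * L + 1))) →
      IsCellLipBound (cellOf q) (orbitWeight r α q)
        (windowAvg (torusYM r.ρ β (2 * L + 1)) (Finset.univ.filter fun e : Edge 4 (2 * L + 1) =>
          lo ≤ StubTorusFrames.ulabel b K (e.1 0 - o).val ∧
            StubTorusFrames.ulabel b K (e.1 0 - o).val ≤ hi) h) (fun _ => δ) := by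
    intro lo hi h hlo hloK hhi hhm hhb hhdep
    have hFR := dependsOn_windowAvg_interval r hb hK o β hlo hhi hhm hhdep
    refine ⟨fun _ => hδ0, fun c σ τ hστ => ?_⟩
    by_cases hc : c 0 = ((lo - 1 : ℕ) : ZMod (μ 0 + 1)) ∨ c 0 = ((hi + 1 : ℕ) : ZMod (μ 0 + 1))
    · refine abs_windowAvg_sub_le_orbitWeight_frame r β α hα q hframe _ c (fun e he heq => ?_)
        hhm hhdep hhb σ τ hστ
      have hl := (Finset.mem_filter.1 he).2
      have h0 : cellOf q e 0 = c 0 := by rw [heq]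
      rw [hcell e] at h0
      have hK1 : StubTorusFrames.ulabel b K (e.1 0 - o).val ≤ K := ulabel_le _
      rcases hc with hc | hc <;> rw [hc] at h0
      · have := natCast_inj_of_le hK1 (by omega) h0; omega
      · have := natCast_inj_of_le hK1 (by omega) h0; omega
    · have heq : windowAvg (torusYM r.ρ β (2 * L + 1)) _ h σ =
          windowAvg (torusYM r.ρ β (2 * L + 1)) _ h τ :=
        hFR fun e he => hστ e fun hce => hc (by
          rw [← hce, hcell e]
          rcases he with h' | h'
          · left; rw [h']
          · right; rw [h'])
      rw [heq, sub_self, abs_zero]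
      exact mul_nonneg hδ0 (hw0 c σ τ)
  have hLipF := hLip (lo := 2) (hi := 2 + wb) (by norm_num) (by omega) F1 hfm hfb hfΛ
  have hLipG := hLip (lo := g₁ + 2) (hi := g₂ + 2) (by omega) (by omega) hg₂K hgm hgb hgΛ
  -- separation of the layers
  have hD : ∀ x ∈ ΔF, ∀ y ∈ ΔG, nb - 3 ≤ cdist x y := by
    intro x hx y hy
    have hx' := (Finset.mem_filter.1 hx).2
    have hy' := (Finset.mem_filter.1 hy).2
    rcases hx' with hx' | hx' <;> rcases hy' with hy' | hy'
    · obtain ⟨h12, hD1, hD2⟩ := hpairs _ _ (Or.inl rfl) (Or.inl rfl)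
      exact le_cdist_of_labels (μ := μ) rfl x y hx' hy' h12 (by omega) hD1 hD2
    · obtain ⟨h12, hD1, hD2⟩ := hpairs _ _ (Or.inl rfl) (Or.inr rfl)
      exact le_cdist_of_labels (μ := μ) rfl x y hx' hy' h12 (by omega) hD1 hD2
    · obtain ⟨h12, hD1, hD2⟩ := hpairs _ _ (Or.inr rfl) (Or.inl rfl)
      exact le_cdist_of_labels (μ := μ) rfl x y hx' hy' h12 (by omega) hD1 hD2
    · obtain ⟨h12, hD1, hD2⟩ := hpairs _ _ (Or.inr rfl) (Or.inr rfl)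
      exact le_cdist_of_labels (μ := μ) rfl x y hx' hy' h12 (by omega) hD1 hD2
  -- the two-region tower identity and the decay interface
  have hmain := abs_corr_le_of_layers_of_decay (μ := μ) hT (cellOf q) (orbitWeight r α q)
    (torusYM r.ρ β (2 * L + 1)) hγ _ hGibbs hdecq hfm hgm hfb hgb ΛF ΛG hgΛ hdisj
    ΔF ΔG hFh hGh hΔFG hLipF hLipG (nb - 3) hD
  refine hmain.trans ?_
  have hcard : ∀ Δ : Finset (CoarseIdx μ), (Δ.card : ℝ) ≤ ((K : ℝ) + 1) ^ 4 := fun Δ => by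
    have h1 : Δ.card ≤ Fintype.card (CoarseIdx μ) := Finset.card_le_univ Δ
    have h2 : Fintype.card (CoarseIdx μ) = (K + 1) ^ 4 := by
      simp [CoarseIdx, Fintype.card_pi, ZMod.card, hμdef, Finset.prod_const, Finset.card_univ]
    rw [h2] at h1
    exact_mod_cast h1
  calc C₀ * (ΔF.card * δ) * (ΔG.card * δ) * Real.exp (-(κ * (nb - 3 : ℕ)))
      ≤ C₀ * (((K : ℝ) + 1) ^ 4 * δ) * (((K : ℝ) + 1) ^ 4 * δ) * Real.exp (-(κ * (nb - 3 : ℕ))) := by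
        gcongr
        · exact hcard ΔF
        · exact hcard ΔG
    _ = _ := by ring

/-- **One torus, far case, for the reflected autocorrelation, through the decay interface.**
Under the hypotheses of `abs_cov_slab_le_far_of_decay`, for a bounded measurable complex slab
observable `X` (links based at lattice times `1 … w`):
`‖osCorr μ Θ₀ τ_N X X‖ ≤ 4 C₀ ((K+1)⁴ δ)² e^{−κ(N/b−3)}` — `osCorr` is the complex covariance of
`conj X∘Θ₀` (supported at times `≥ 2L − w`) and `X∘τ_N` (times `N+1 … N+w`), i.e. four real
covariances of slab observables. Fork of `SlabClustering.norm_osCorr_le_far`. -/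
theorem norm_osCorr_le_far_of_decay (hT : SpecificationTower) {n₀ : ℕ} {κ C₀ : ℝ} (hC₀ : 0 ≤ C₀)
    (β α : ℝ) (hα : 0 < α) {L b K w N : ℕ} (hb : 0 < b) (hK : K + 1 = (2 * L + 1) / b)
    (hbL : 4 * b ≤ L) (hNw : N + 2 * w ≤ L) (hN : 3 * b ≤ N) (hn₀ : 2 * n₀ + 3 ≤ K + 1)
    (hγ : IsSpecification (torusYM r.ρ β (2 * L + 1)))
    (hGibbs : IsGibbsMeasure (torusYM r.ρ β (2 * L + 1)) (wilsonMeasure (d := 4) (L := 2 * L + 1) r.ρ β))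
    (hdec : ∀ (μ : Fin 4 → ℕ) (q : (i : Fin 4) → ZMod (2 * L + 1) → ZMod (μ i + 1)),
        (∀ i, 2 * n₀ + 3 ≤ μ i + 1) → (∀ i, IsTorusFrame (2 * L + 1) b (q i)) →
          CellDecay (cellOf q) (orbitWeight r α q)
            (wilsonMeasure (d := 4) (L := 2 * L + 1) r.ρ β) κ C₀)
    {X : GaugeConfig 4 (2 * L + 1) G → ℂ} {B : ℝ} (hXm : Measurable X) (hXb : ∀ U, ‖X U‖ ≤ B)
    (hXdep : DependsOn X {e : Edge 4 (2 * L + 1) | 1 ≤ (e.1 0).val ∧ (e.1 0).val ≤ w}) :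
    ‖osCorr (wilsonMeasure (d := 4) (L := 2 * L + 1) r.ρ β) GaugeConfig.negReflect
        (torusTimeShift (2 * L + 1) N) X X‖ ≤
      4 * (C₀ * ((K + 1 : ℝ) ^ 4 * (2 * B * (1 + 2 * Real.exp 2 * |β| * α * (7680 * (b : ℝ) ^ 4)))) ^ 2 *
        Real.exp (-(κ * (N / b - 3 : ℕ)))) := by
  -- adapted from `SlabClustering.norm_osCorr_le_far` (…SlabClusteringFar)
  haveI : IsProbabilityMeasure (wilsonMeasure (d := 4) (L := 2 * L + 1) r.ρ β) := hGibbs.1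
  rw [osCorr_negReflect_eq_cov r.ρ r.continuous β N hXm]
  set F : GaugeConfig 4 (2 * L + 1) G → ℂ := fun U => conj (X (GaugeConfig.negReflect U)) with hF
  set Gc : GaugeConfig 4 (2 * L + 1) G → ℂ := fun U => X (torusTimeShift (2 * L + 1) N U) with hGc
  have hFm : Measurable F :=
    Complex.continuous_conj.measurable.comp (hXm.comp WilsonSiteRP.measurable_negReflect)
  have hGm : Measurable Gc := hXm.comp (torusTimeShift (2 * L + 1) N).measurable
  have hFb : ∀ U, ‖F U‖ ≤ B := fun U => by simp only [hF, RCLike.norm_conj]; exact hXb _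
  have hGb : ∀ U, ‖Gc U‖ ≤ B := fun U => hXb _
  have hFdep : DependsOn F {e : Edge 4 (2 * L + 1) | 2 * L - w ≤ (e.1 0).val} := fun U V h =>
    congrArg (starRingEnd ℂ) (dependsOn_comp_negReflect_slab (by omega) hXdep h)
  have hGdep : DependsOn Gc {e : Edge 4 (2 * L + 1) | 1 + N ≤ (e.1 0).val ∧ (e.1 0).val ≤ w + N} :=
    Transfer.Hankel.dependsOn_comp_torusTimeShift hXdep N (by omega)
  have dre : ∀ {H : GaugeConfig 4 (2 * L + 1) G → ℂ} {s : Set (Edge 4 (2 * L + 1))},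
      DependsOn H s → DependsOn (fun U => (H U).re) s := fun hH U V hUV =>
    congrArg Complex.re (hH hUV)
  have dim : ∀ {H : GaugeConfig 4 (2 * L + 1) G → ℂ} {s : Set (Edge 4 (2 * L + 1))},
      DependsOn H s → DependsOn (fun U => (H U).im) s := fun hH U V hUV =>
    congrArg Complex.im (hH hUV)
  have bre : ∀ {H : GaugeConfig 4 (2 * L + 1) G → ℂ}, (∀ U, ‖H U‖ ≤ B) → ∀ U, |(H U).re| ≤ B :=
    fun hH U => (Complex.abs_re_le_norm _).trans (hH U)
  have bim : ∀ {H : GaugeConfig 4 (2 * L + 1) G → ℂ}, (∀ U, ‖H U‖ ≤ B) → ∀ U, |(H U).im| ≤ B :=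
    fun hH U => (Complex.abs_im_le_norm _).trans (hH U)
  refine norm_cov_complex_le _ hFm hGm hFb hGb ?_ ?_ ?_ ?_
  · exact abs_cov_slab_le_far_of_decay r hT hC₀ β α hα hb hK hbL hNw hN hn₀ hγ hGibbs hdec
      (Complex.measurable_re.comp hFm) (Complex.measurable_re.comp hGm) (bre hFb) (bre hGb)
      (dre hFdep) (dre hGdep)
  · exact abs_cov_slab_le_far_of_decay r hT hC₀ β α hα hb hK hbL hNw hN hn₀ hγ hGibbs hdec
      (Complex.measurable_im.comp hFm) (Complex.measurable_im.comp hGm) (bim hFb) (bim hGb)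
      (dim hFdep) (dim hGdep)
  · exact abs_cov_slab_le_far_of_decay r hT hC₀ β α hα hb hK hbL hNw hN hn₀ hγ hGibbs hdec
      (Complex.measurable_re.comp hFm) (Complex.measurable_im.comp hGm) (bre hFb) (bim hGb)
      (dre hFdep) (dim hGdep)
  · exact abs_cov_slab_le_far_of_decay r hT hC₀ β α hα hb hK hbL hNw hN hn₀ hγ hGibbs hdec
      (Complex.measurable_im.comp hFm) (Complex.measurable_re.comp hGm) (bim hFb) (bre hGb)
      (dim hFdep) (dre hGdep)

end OneTorus

end SlabClusteringOfDecay

end Summit.QuantumFields.YangMills.Cruxes.LatticeGapOnTrajectory.SparseDefectOrbitWindow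

end
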